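import Summits.KontsevichZagierPeriods.KontsevichZagierPeriods.Theses.HyperbolicBloch

/-!
# `SectorReduction` (stmt-KontsevichZagierPeriods-3472): `FiveTermTransfer → TetraSector`

Route `HyperbolicBloch`, support item #9. The sector statement `TetraSector` (kernel form of
Conjecture 1 on the subgroup of `FormalRep` generated by the standard ideal-tetrahedron
representations `ρ z = [T(z), t⁻³]`, conditional on Zagier's dilogarithm conjecture in
volume/`ℤ`-form) follows from the five-term transfer theorem `FiveTermTransfer` by pure algebra:

* `value (ρ z) = ∫_{T z} t⁻³` (`setIntegral_congr_fun`, the domain of a representation is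
  measurable), so the vanishing combination of values is a vanishing combination of volumes and
  Zagier's hypothesis puts `Σ nᵢ [zᵢ]` in the `ℤ`-span of the three relator families;
* the sign-corrected assignment `B w = [ρ w]` (`Im w > 0`), `−[ρ w̄]` (`Im w < 0`), `0` (`w` real)
  extends to `φ : FreeAbelianGroup ℂ →+ FormalRep` (`FreeAbelianGroup.lift`);
* `φ` maps five-term relators into `KZ.relations` (this is `FiveTermTransfer`), and the relators
  `[w] + [w̄]`, `[w]` (`w` real) to `0` (definition of `B`), so `closure ≤ comap φ relations`
  (`AddSubgroup.closure_le`);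
* `φ (Σ nᵢ [zᵢ]) = Σ nᵢ [ρ zᵢ]` because every `zᵢ` lies in the upper half plane.

References: Dupont–Sah 1982 (§5, the five-term relation generates); Kontsevich–Zagier 2001 §1.2.
-/

noncomputable section

open MeasureTheory Set Complex
open scoped ComplexConjugate BigOperators

namespace Summit.KontsevichZagierPeriods.HyperbolicBloch.SectorReduction

open Literature.NumberTheory.Transcendental
open Literature.NumberTheory.Transcendental.KZ
open Summit.KontsevichZagierPeriods.KontsevichZagierPeriods.Theses.HyperbolicBloch
  (FiveTermTransfer TetraSector SectorReduction)

/-- The value of a representation whose domain is `T` and whose integrand agrees with `f` on `T`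
is `∫ p in T, f p`. -/
theorem value_eq_setIntegral_of_eqOn {r : IntegralRep 3} {T : Set (Fin 3 → ℝ)}
    {f : (Fin 3 → ℝ) → ℝ} (hdom : r.domain = T) (heq : EqOn r.integrand f T) :
    r.value = ∫ p in T, f p := by
  have hm : MeasurableSet T := hdom ▸ IntegralRep.measurableSet_domain_holds r
  rw [IntegralRep.value, hdom]
  exact setIntegral_congr_fun hm heq

/-- The sign-corrected tetrahedron class `B` kills the relator `[w] + [w̄]`. -/
theorem B_add_B_conj_eq_zero (ρ : ℂ → IntegralRep 3) (B : ℂ → FormalRep)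
    (hB : ∀ z, B z = if 0 < z.im then KZ.of (ρ z)
      else if z.im < 0 then -KZ.of (ρ (conj z)) else 0)
    (w : ℂ) : B w + B (conj w) = 0 := by
  rw [hB w, hB (conj w)]
  simp only [Complex.conj_im, Complex.conj_conj, Left.neg_pos_iff, Left.neg_neg_iff]
  rcases lt_trichotomy w.im 0 with h | h | h
  · rw [if_neg (not_lt.mpr h.le), if_pos h, if_pos h]
    exact neg_add_cancel _
  · rw [if_neg (by rw [h]; exact lt_irrefl 0), if_neg (by rw [h]; exact lt_irrefl 0),
      if_neg (by rw [h]; exact lt_irrefl 0), if_neg (by rw [h]; exact lt_irrefl 0), add_zero]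
  · rw [if_pos h, if_neg (not_lt.mpr h.le), if_pos h]
    exact add_neg_cancel _

/-- The sign-corrected tetrahedron class `B` vanishes at real arguments. -/
theorem B_eq_zero_of_im_eq_zero (ρ : ℂ → IntegralRep 3) (B : ℂ → FormalRep)
    (hB : ∀ z, B z = if 0 < z.im then KZ.of (ρ z)
      else if z.im < 0 then -KZ.of (ρ (conj z)) else 0)
    (w : ℂ) (hw : w.im = 0) : B w = 0 := by
  rw [hB w, if_neg (by rw [hw]; exact lt_irrefl 0), if_neg (by rw [hw]; exact lt_irrefl 0)]

/-- **`SectorReduction`** (route `HyperbolicBloch`, stmt-KontsevichZagierPeriods-3472): the five-term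
transfer theorem reduces the tetrahedral sector of the kernel form of Conjecture 1 to Zagier's
dilogarithm conjecture — `FiveTermTransfer → TetraSector`. Pure algebra: lift the sign-corrected
class `B` to `FreeAbelianGroup ℂ →+ FormalRep` and check the three relator families.
[Dupont–Sah 1982 §5; Kontsevich–Zagier 2001 §1.2] -/
theorem sectorReduction_proof : SectorReduction := by
  intro hFT T hT hZ ρ hρ k z n halg him hsum
  -- (1) values are volumes
  have hval : ∀ i, (ρ (z i)).value = ∫ p in T (z i), 1 / p 2 ^ 3 := fun i =>
    value_eq_setIntegral_of_eqOn (hρ (z i) (halg i) (him i)).1 (hρ (z i) (halg i) (him i)).2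
  have hsum' : ∑ i, (n i : ℝ) * (∫ p in T (z i), 1 / p 2 ^ 3) = 0 := by
    simpa only [hval] using hsum
  have hmem := hZ k z n halg him hsum'
  -- (2) the sign-corrected class and its additive extension
  obtain ⟨B, hB⟩ : ∃ B : ℂ → FormalRep, ∀ w, B w = if 0 < w.im then KZ.of (ρ w)
      else if w.im < 0 then -KZ.of (ρ (conj w)) else 0 := ⟨_, fun _ => rfl⟩
  let φ : FreeAbelianGroup ℂ →+ FormalRep := FreeAbelianGroup.lift B
  have hφ : ∀ w, φ (FreeAbelianGroup.of w) = B w := fun w => FreeAbelianGroup.lift_apply_of _ _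
  -- (3) every relator is mapped into `relations`
  have hle : AddSubgroup.closure
      ({c : FreeAbelianGroup ℂ | ∃ x y : ℂ, IsAlgebraic ℚ x ∧ IsAlgebraic ℚ y ∧ x ≠ 0 ∧ x ≠ 1 ∧
          y ≠ 0 ∧ y ≠ 1 ∧ x ≠ y ∧ c = FreeAbelianGroup.of x - FreeAbelianGroup.of y +
          FreeAbelianGroup.of (y / x) - FreeAbelianGroup.of ((1 - x⁻¹) / (1 - y⁻¹)) +
          FreeAbelianGroup.of ((1 - x) / (1 - y))} ∪
        {c | ∃ w : ℂ, IsAlgebraic ℚ w ∧ c = FreeAbelianGroup.of w +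
          FreeAbelianGroup.of ((starRingEnd ℂ) w)} ∪
        {c | ∃ w : ℂ, w.im = 0 ∧ c = FreeAbelianGroup.of w}) ≤ relations.comap φ := by
    rw [AddSubgroup.closure_le]
    rintro c ((⟨x, y, hx, hy, hx0, hx1, hy0, hy1, hxy, rfl⟩ | ⟨w, -, rfl⟩) | ⟨w, hw, rfl⟩)
    · simp only [SetLike.mem_coe, AddSubgroup.mem_comap, map_add, map_sub, hφ]
      exact hFT T hT ρ hρ B hB x y hx hy hx0 hx1 hy0 hy1 hxy
    · simp only [SetLike.mem_coe, AddSubgroup.mem_comap, map_add, hφ]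
      rw [B_add_B_conj_eq_zero ρ B hB w]
      exact zero_mem _
    · simp only [SetLike.mem_coe, AddSubgroup.mem_comap, hφ]
      rw [B_eq_zero_of_im_eq_zero ρ B hB w hw]
      exact zero_mem _
  -- (4) the image of `Σ nᵢ [zᵢ]`
  have hφsum : φ (∑ i, n i • FreeAbelianGroup.of (z i)) = ∑ i, n i • KZ.of (ρ (z i)) := by
    rw [map_sum]
    refine Finset.sum_congr rfl fun i _ => ?_
    rw [map_zsmul, hφ, hB, if_pos (him i)]
  have h2 : (∑ i, n i • FreeAbelianGroup.of (z i)) ∈ relations.comap φ := hle hmem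
  rwa [AddSubgroup.mem_comap, hφsum] at h2

end Summit.KontsevichZagierPeriods.HyperbolicBloch.SectorReduction

end
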